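import Literature.MathematicalPhysics.QuantumFieldTheory.Balaban1983to89.B9Cor36SiteSandwichTransfer
import Literature.MathematicalPhysics.QuantumFieldTheory.Balaban1983to89.B9Cor35GCubeInputsAtOne
import Literature.MathematicalPhysics.QuantumFieldTheory.Balaban1983to89.B9CubeLettersInvWriteDictB
import Literature.MathematicalPhysics.QuantumFieldTheory.Balaban1983to89.Node00.OpsYNablaBridge

/-!
# `Balaban1983to89.B9Cor36BondSandwichTransfer` — [Balaban1985BackgroundPropagators] COROLLARY 3.6 p. 408 ∕ THEOREM 3.10 p. 415 BOOKKEEPING, BOND SECTOR: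
# a [4]-(2.51) block majorant of a BOND-SECTOR operator over the CUBE SEQUENCE's blocks, sandwiched between a bi-contractive gauge rotation
# `R(u)⁻¹ … R(u)` (read at `b₋`) and two scalar cut-offs `M_{g₁} … M_{g₂}` (read at `b₋`, the right one supported near □), IS a block majorant over the
# MEMBER's blocks with the same rate — the transfer the member-side (3.42) block `hE` of the cut bond letter `O_□ = χ_□R(u)⁻¹G_□(Ṽ_□)R(u)χ_□` needs,
# once for each of its terms (sub-row G-B9-LETTERS, module M5.1b-G, FILE G-F6b-T; the bond twin of p33's site-sector FILE 7b-B `B9Cor36SiteSandwichTransfer`)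

T. Bałaban, *Propagators for lattice gauge theories in a background field*, Commun. Math. Phys. **99** (1985) 389–434
[`Balaban1985BackgroundPropagators`, "B9"]; [4] = T. Bałaban, *Propagators and renormalization transformations for lattice gauge theories. II*,
Commun. Math. Phys. **96** (1984) 223–250 [`Balaban1984PropagatorsII`].

statement-level skeleton of published theorems with citation tags; proofs where landed; nothing here is a claim about the
Yang–Mills mass gap

THE PRINTED LOCUS (verbatim, held `paper:balaban1985-cmp99-background-propagators`, journal page = PDF page + 388; page owner r06).  Cor. 3.6 p. 408
l. 1–14: *«the operators G_□(U), G′_□(U) … satisfy (3.42)–(3.47) for x, y, y′ ∈ □̃»*; *«all the results of these theorems are gauge invariant, so they hold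
for the configuration U also»*; (3.89) p. 409 (*«for x ∈ Δ(y), supp λ ⊂ Δ(y′), y, y′ ∈ □»* — read in the MEMBER's blocks); (3.28)–(3.33) pp. 395–396
(`R(u)` and the covariance of the letters: *«(R(u)U′)(x, x′) = R(u(x))U′(x, x′)»* — the rotation of a bond function is read at the initial point);
Thm 3.3 (3.42) p. 397∕399 (*«with λ replaced by a function J defined at bonds»*).  [4] (2.51)–(2.55) p. 232 (*«|(Tλ)(x)| ≦ K(y,y′)|λ|»*, *«this property is
preserved under the composition of operators possessing it»*), (2.45)–(2.46) p. 231 (the blocks and their distance), p. 224 (*«Ω also the set of bonds»*: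
a bond belongs to the block of its initial point).

WHY THIS FILE (cell `lit-balaban`; module M5.1b-G, p38 g44; successor plan `lit-balaban-p38/RECORD-M51bG-g43.md` §Remaining item 3).  M5.7's consumer
(`B9Thm310DeltaAIsUnitOfExpansion.eBlock_kernelFamilyBInv_GAY_of_localInverseCubes''`) displays, per cover cube, `hE : EBlock (kernelFamilyBInv i B cfg (O_□)
par) B₀ δ₀ U₁` for the cut transported bond letter `O_□ = M_χ·R(u)⁻¹·G_□(Ṽ_□)·R(u)·M_χ` (G-F2 `B9Cor36GCubeLocLetter.locLetterBY`) over def-Y's MEMBER geometry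
`toB6 (geo9K i)` (block map `(f, j) ↦ ιB(Δ(f₋))`, the bond writer `B9CubeLettersInvWriteDictB.eBlock_kernelFamilyBInv_of_hasMajorant`).  G-F6a
(`B9Cor36GCubeEntriesAtV`) delivers the majorants of `conj b(G_□(Ṽ_□))` and its covariant-derivative composites over the CUBE SEQUENCE's geometry `toB6
(geoCK i □)` (block map `blkBK i □ : (f, j) ↦ Δ_□(f₋)`).  After the transport∕Leibniz identities (G-F6b) every term of the four member-side operators is a
SANDWICH `M_{g₁}·R(u)⁻¹·M·R(u)·M_{g₂}` of a cube-side bond operator `M` with scalar multipliers read at `b₋` (`χ`, its shifts and lattice derivatives) — the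
right one supported near □.  THIS FILE is the transfer lemma in between, the bond twin of p33's `hasMajorant_conj_site_sandwich` (same sites, same blocks:
a bond sits in the block of its initial point in BOTH families, so r05's coarsening facts at `b₋` are all that is needed).

WHAT THIS FILE PROVES (theorems only; 0 `def`, 0 `def … : Prop`, 0 sorry).
* (the two block maps at a bond — cube `blkBK i □ (f, j) = Δ_□(f₋)` (G-F6a `blkBK_eq`), member `blkV1 i.hN i.D f = Δ(f₋)` (`B9Eq346GradGpDivTorusL2.blkV1_eq_blkOf_chartY`)
  — hold by `rfl` and are used definitionally.)
* §1 ★★★ `hasMajorant_conj_bond_sandwich` — GENERIC: `conj b M ≺ K_C` over `(toB6 (geoCK i □), blkBK i □)`, `|g₁(f)| ≤ G₁(Δ_□(f₋))`, `|g₂(f)| ≤ G₂(Δ_□(f₋))`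
  with `g₂(f) ≠ 0 ⟹ f₋` near □ (`NearH`), `u` bi-contractive (read at `b₋`: `gBondY`-shaped gauges `γ : FBondY → 𝔸ˣ` with `γ f` depending on `f` freely),
  a member kernel `K ≥ 0` with `G₁(Δ_□f)·K_C(Δ_□f, Δ_□f₀)·G₂(Δ_□f₀) ≤ K(ιBΔ(f₋), ιBΔ(f₀₋))` at active sources `f₀` ⟹
  `conj b(M_{g₁}R(γ)⁻¹MR(γ)M_{g₂}) ≺ (M₂Σ_j‖b_j‖)²·K` over `(toB6 (geo9K i), (f, j) ↦ ιB(Δ(f₋)))`.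
* §2 ★★ `hasMajorant_conj_bond_sandwich_decay` (`K_C = B·ℓ_□(a)ⁿ·e^{−δd_□}`, `|g₁| ≤ c₁·ℓ_□⁻ᵐ`, `m ≤ n`, `|g₂| ≤ c₂` ⟹ `≺ (M₂Σ‖b‖)²c₁c₂B·ℓ(a)^{n−m}·e^{−δd}`),
  ★★ `hasMajorant_conj_bond_sandwich_decay_src` (the source-weighted variant for the right cut-off derivative of (3.42)₃: `|g₂| ≤ c₂·ℓ_□⁻¹`, `n = 2`, one
  scale transfer of the cube geometry).

PROOF.  p33's FILE 7b-B proof VERBATIM with the site `z` replaced by the bond's initial point `f₋` (`chartY i f.src`); [4]'s (2.51) bookkeeping; r05's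
coarsening facts (`len_cube_le_len_member`, `dist_member_le_dist_cube`, `blkCubeY_eq_of_blkOf_eq_of_nearH`) BY NAME from FILE 7b-B §2.

HONEST SCOPE ∕ NOT CLAIMED.  Finite bookkeeping; NO estimate of [B9] is proved (the cube-side majorant `hM` is a HYPOTHESIS — G-F6a supplies it).  The two
factors `M₂Σ‖b‖` are the passage `𝔸 ⇄` real coordinates at the two rotations (print: «gauge invariant», exact; here «with different constants», p. 403).
Inhabited: `g₂ := 0` gives the zero operator and `0 ≺ K`; not a vacuous schema.  Nothing on `d = 4`, the continuum, reflection positivity or the mass gap;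
NOT a node discharge; no summit ∕ sub-problem statement is proved; YM mass gap NOT proved by any of this (Track A conditional rung).  No `sorry`, no `axiom`,
no `… : Prop` fact, no `instance`, no `notation`, no `def`.  NEW file; nothing landed is modified.  Cell `lit-balaban`, seat `lit-balaban-p38` gen 44,
2026-08-28; `--supports stmt-QuantumFields-19200` as helper.  Net new unproved facts: 0.

RELATED IN THE TREE, NOT DUPLICATED (searched 2026-08-28: `rg 'bond_sandwich|BondSandwich'` over `Literature/` = ∅): p33 `B9Cor36SiteSandwichTransfer` (the
SITE-sector twin; its §1 row-local rules and §2 coarsening facts USED BY NAME), p21 `B9Cor36CinvCubeLocLetterMajorant.hasMajorant_conj_bridge_sandwich` (block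
carriers with a bridge `J`; `norm_le_sum_mul_of_repr_le` USED BY NAME), r05 `B9CubeCoarsening.majorant_transfer_of_nearH` (scalar operators), T9
`B9Eq352DivFormLetters` (`conj`, `coordEquiv`).
-/

noncomputable section

namespace Literature.MathematicalPhysics.QuantumFieldTheory.Balaban1983to89.B9Cor36BondSandwichTransfer

open B6RandomWalk (HasMajorant BlockSupp hasMajorant_mono)
open B9Thm34Ext (toB6)
open B9Ineq347 (ScaleTransfer)
open B9Eq39Adjoint (R R_zero R_smul)
open B9Eq352DivFormLetters (conj conj_apply coordEquiv coordEquiv_apply coordEquiv_symm_apply norm_coordSymm_apply_le)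
open B6KLevelCensusIndexV1 (KIdx kGeo)
open B6Cover236MultiLevelBlocks (cubes)
open B6Geom246MultiLevelBox (bset blkOf)
open B6GlobalChartV1 (blkV1)
open B6Ineq2142KLevelV1 (β)
open B9GeoNormsKLevelV1 (geo9K)
open B9CubeSequence408 (NearH)
open B9CubeLettersOpsL0 (cubeFamY)
open B9CubeLettersBondOpsL0 (BlkCubeY)
open B9Eq360DeltaPrimeACubeY (blkCubeY)
open B9CubeGeometryInputs (geoCK geoCK_len_pos geoCK_dist_axioms)
open B9Thm37CubeCoverCommutators (cutMulY cutMulY_apply)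
open B9Cor36CinvCubeLocLetterMajorant (norm_le_sum_mul_of_repr_le)
open B9Cor36SiteSandwichTransfer (len_cube_le_len_member dist_member_le_dist_cube blkCubeY_eq_of_blkOf_eq_of_nearH)
open B9Cor35GCubeInputsAtOne (blkBK)
open Node00 (SiteY BlkY IBondY FBondY conjY conjY_apply toKT)
open Node00.OpsYNablaBridge (chartY)

variable {d ℓ : ℕ} {hd : 1 ≤ d + 1} {hL : Odd (ℓ + 1) ∧ 1 < ℓ + 1} {b₀ b₁ : ℝ}
variable {𝔸 : Type} [NormedRing 𝔸] [NormedAlgebra ℂ 𝔸] [CompleteSpace 𝔸]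
variable {ι : Type} [Fintype ι]

/-! ## §1  ★★★ The bond-sector sandwich transfer: cube-sequence blocks → member blocks -/

section Transfer

variable (i : KIdx d ℓ hd hL b₀ b₁) (c : ↥(cubes (toKT i).D.toDomains)) (b : Module.Basis ι ℝ 𝔸)

omit [CompleteSpace 𝔸] in
/-- ★★★ **THE BOND-SECTOR SANDWICH TRANSFER.**  Let `M` be an `ℝ`-linear operator on the `𝔸`-valued bond functions whose coordinate conjugate has the block
majorant `K_C` over the cube sequence's geometry `(toB6 (geoCK i □), blkBK i □)`; let `γ` be a bi-contractive field of units on the bonds (the gauge `u`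
read at `b₋`), `g₁, g₂` real multipliers on bonds with `|g₁(f)| ≤ G₁(Δ_□(f₋))`, `|g₂(f)| ≤ G₂(Δ_□(f₋))` and `g₂` supported on bonds with initial point
near □; let `K ≥ 0` be a kernel on the member's carrier indices dominating `G₁(Δ_□f)·K_C(Δ_□f, Δ_□f₀)·G₂(Δ_□f₀)` for every row bond `f` and every active
source bond `f₀`.  Then over the member's geometry `(toB6 (geo9K i), (f, j) ↦ ιB(Δ(f₋)))`: `conj b (M_{g₁}·R(γ)⁻¹·M·R(γ)·M_{g₂}) ≺ (M₂Σ_j‖b_j‖)²·K`.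
[cite: Balaban1985BackgroundPropagators, Cor. 3.6 p.408 l.1–14, (3.89) p.409, (3.28)–(3.33) pp.395–396, Thm 3.3 p.399; Balaban1984PropagatorsII, (2.51)–(2.55) p.232, (2.45)–(2.46) p.231, p.224] -/
theorem hasMajorant_conj_bond_sandwich {M₂ : ℝ} (hM₂ : 0 ≤ M₂) (hrepr : ∀ (v : 𝔸) (j : ι), |b.repr v j| ≤ M₂ * ‖v‖)
    (γ : FBondY i → 𝔸ˣ) (hγ : ∀ f a, ‖R (γ f) a‖ ≤ ‖a‖ ∧ ‖R (γ f)⁻¹ a‖ ≤ ‖a‖)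
    (g₁ g₂ : FBondY i → ℝ) (G₁ G₂ : BlkCubeY i c → ℝ) (hG₁ : ∀ f, |g₁ f| ≤ G₁ (blkCubeY i c (chartY i f.src)))
    (hG₂ : ∀ f, |g₂ f| ≤ G₂ (blkCubeY i c (chartY i f.src)))
    (hnear : ∀ f, g₂ f ≠ 0 → NearH c (chartY i f.src).1)
    (ιB : BlkY i → IBondY i) (hι : ∀ s, β i.hN i.D i.hk (ιB s) = s) (Rr : ℝ) (H : Prop) [Fintype (geo9K i).Site] (Rr' : ℝ) (Hp : Prop)
    {KC : BlkCubeY i c → BlkCubeY i c → ℝ} {K : IBondY i → IBondY i → ℝ} (hK : ∀ a a', 0 ≤ K a a')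
    (hcmp : ∀ x x₀ : FBondY i, g₂ x₀ ≠ 0 →
      G₁ (blkCubeY i c (chartY i x.src)) * KC (blkCubeY i c (chartY i x.src)) (blkCubeY i c (chartY i x₀.src)) * G₂ (blkCubeY i c (chartY i x₀.src)) ≤
        K (ιB (blkOf i.D.toDomains (chartY i x.src))) (ιB (blkOf i.D.toDomains (chartY i x₀.src))))
    (M : Module.End ℝ (FBondY i → 𝔸)) (hM : HasMajorant (g := toB6 (geoCK i c) Rr H) (blkBK i c) (conj b M) KC) :
    HasMajorant (g := toB6 (geo9K i) Rr' Hp) (fun p : FBondY i × ι => ιB (blkV1 i.hN i.D p.1))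
      (conj b ((cutMulY (𝔸 := 𝔸) g₁).restrictScalars ℝ ∘ₗ (conjY γ⁻¹).restrictScalars ℝ ∘ₗ M ∘ₗ (conjY γ).restrictScalars ℝ ∘ₗ
        (cutMulY (𝔸 := 𝔸) g₂).restrictScalars ℝ))
      (fun a a' => (M₂ * ∑ j, ‖b j‖) ^ 2 * K a a') := by
  intro y' μ B hμ x
  have hSb : 0 ≤ ∑ j, ‖b j‖ := Finset.sum_nonneg fun _ _ => norm_nonneg _
  have hKB : 0 ≤ (M₂ * ∑ j, ‖b j‖) ^ 2 * K (ιB (blkV1 i.hN i.D x.1)) y' * B := mul_nonneg (mul_nonneg (sq_nonneg _) (hK _ _)) hμ.nonneg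
  -- the source as an `𝔸`-valued bond function, cut and rotated
  set lam : FBondY i → 𝔸 := (coordEquiv b).symm μ with hlam
  set ν : FBondY i → 𝔸 := conjY γ (cutMulY g₂ lam) with hν
  rw [conj_apply]
  simp only [LinearMap.comp_apply, LinearMap.restrictScalars_apply]
  rw [← hlam]
  change |b.repr (cutMulY g₁ (conjY γ⁻¹ (M ν)) x.1) x.2| ≤ (M₂ * ∑ j, ‖b j‖) ^ 2 * K (ιB (blkV1 i.hN i.D x.1)) y' * B
  rw [cutMulY_apply, conjY_apply, Pi.inv_apply]
  -- the row factor: `|repr (g₁(x)·R(γ(x))⁻¹ a)| ≤ M₂·|g₁ x|·‖a‖`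
  have hrowfac : |b.repr ((((g₁ x.1 : ℝ) : ℂ)) • R (γ x.1)⁻¹ (M ν x.1)) x.2| ≤ M₂ * (G₁ (blkCubeY i c (chartY i x.1.src)) * ‖M ν x.1‖) := by
    refine (hrepr _ _).trans (mul_le_mul_of_nonneg_left ?_ hM₂)
    rw [norm_smul, Complex.norm_real, Real.norm_eq_abs]
    exact mul_le_mul (hG₁ x.1) ((hγ x.1 _).2) (norm_nonneg _) ((abs_nonneg _).trans (hG₁ x.1))
  -- the source: every value of `lam` is bounded by `(Σ‖b‖)·B`, and `lam` vanishes off the member block over `y′`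
  have hlam_bd : ∀ w, ‖lam w‖ ≤ (∑ j, ‖b j‖) * B := fun w => by
    by_cases hw : ιB (blkV1 i.hN i.D w) = y'
    · rw [hlam]; exact norm_coordSymm_apply_le b μ w B fun j => hμ.bound (w, j) hw
    · have h0 : lam w = 0 := by
        rw [hlam, coordEquiv_symm_apply]
        exact Finset.sum_eq_zero fun j _ => by rw [hμ.off (w, j) hw, zero_smul]
      rw [h0, norm_zero]; exact mul_nonneg hSb hμ.nonneg
  have hlam_off : ∀ w, ιB (blkV1 i.hN i.D w) ≠ y' → lam w = 0 := fun w hw => by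
    rw [hlam, coordEquiv_symm_apply]
    exact Finset.sum_eq_zero fun j _ => by rw [hμ.off (w, j) hw, zero_smul]
  have hν_val : ∀ w, ν w = R (γ w) ((((g₂ w : ℝ) : ℂ)) • lam w) := fun w => by rw [hν, conjY_apply, cutMulY_apply]
  -- either `ν = 0`, or there is an active source bond `w₀` (then its initial point is near □, and it lies in the member block over `y′`)
  by_cases hex : ∃ w₀, g₂ w₀ ≠ 0 ∧ lam w₀ ≠ 0
  swap
  · have hν0 : ν = 0 := funext fun w => by
      rw [hν_val]
      by_cases h2 : g₂ w = 0
      · rw [h2, Complex.ofReal_zero, zero_smul, R_zero]; rfl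
      · have hl : lam w = 0 := by
          by_contra hl; exact hex ⟨w, h2, hl⟩
        rw [hl, smul_zero, R_zero]; rfl
    rw [hν0, map_zero, Pi.zero_apply, R_zero, smul_zero, map_zero, Finsupp.zero_apply, abs_zero]
    exact hKB
  obtain ⟨w₀, hg₂w₀, hlamw₀⟩ := hex
  have hy' : ιB (blkV1 i.hN i.D w₀) = y' := by
    by_contra h; exact hlamw₀ (hlam_off w₀ h)
  have hw₀near : NearH c (chartY i w₀.src).1 := hnear w₀ hg₂w₀
  set s₀ : BlkCubeY i c := blkCubeY i c (chartY i w₀.src) with hs₀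
  have hG₂0 : 0 ≤ G₂ s₀ := (abs_nonneg _).trans (hG₂ w₀)
  -- bonds carrying the source have their initial point in the cube block `s₀`
  have hblk : ∀ w, lam w ≠ 0 → blkCubeY i c (chartY i w.src) = s₀ := fun w hw => by
    have h1 : ιB (blkV1 i.hN i.D w) = y' := by
      by_contra h; exact hw (hlam_off w h)
    have h2 : blkOf i.D.toDomains (chartY i w.src) = blkOf i.D.toDomains (chartY i w₀.src) := by
      have h3 := congrArg (β i.hN i.D i.hk) (h1.trans hy'.symm)
      rw [hι, hι] at h3
      exact h3
    exact blkCubeY_eq_of_blkOf_eq_of_nearH i c hw₀near h2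
  -- the coordinates of `ν`: a source over the cube geometry supported in `s₀`
  have hνsupp : BlockSupp (g := toB6 (geoCK i c) Rr H) (blkBK i c) (coordEquiv b ν) s₀ (M₂ * (G₂ s₀ * ((∑ j, ‖b j‖) * B))) := by
    refine ⟨mul_nonneg hM₂ (mul_nonneg hG₂0 (mul_nonneg hSb hμ.nonneg)), fun p hp => ?_, fun p hp => ?_⟩
    · rw [coordEquiv_apply]
      refine (hrepr _ _).trans (mul_le_mul_of_nonneg_left ?_ hM₂)
      rw [hν_val]
      refine ((hγ p.1 _).1).trans ?_
      rw [norm_smul, Complex.norm_real, Real.norm_eq_abs]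
      have hp' : blkCubeY i c (chartY i p.1.src) = s₀ := hp
      exact mul_le_mul ((hG₂ p.1).trans (by rw [hp'])) (hlam_bd p.1) (norm_nonneg _) hG₂0
    · rw [coordEquiv_apply]
      have hl : lam p.1 = 0 := by
        by_contra hl; exact hp (hblk p.1 hl)
      rw [hν_val, hl, smul_zero, R_zero, map_zero, Finsupp.zero_apply]
  -- the cube-side majorant on that source, read at the rows `(x.1, j′)`
  have hrow : ∀ j', |b.repr (M ν x.1) j'| ≤ KC (blkCubeY i c (chartY i x.1.src)) s₀ * (M₂ * (G₂ s₀ * ((∑ j, ‖b j‖) * B))) := fun j' => by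
    have h := hM s₀ (coordEquiv b ν) _ hνsupp (x.1, j')
    rwa [conj_apply, LinearEquiv.symm_apply_apply] at h
  have hnorm : ‖M ν x.1‖ ≤ (∑ j, ‖b j‖) * (KC (blkCubeY i c (chartY i x.1.src)) s₀ * (M₂ * (G₂ s₀ * ((∑ j, ‖b j‖) * B)))) :=
    norm_le_sum_mul_of_repr_le b _ hrow
  have hc : G₁ (blkCubeY i c (chartY i x.1.src)) * KC (blkCubeY i c (chartY i x.1.src)) (blkCubeY i c (chartY i w₀.src)) *
      G₂ (blkCubeY i c (chartY i w₀.src)) ≤ K (ιB (blkV1 i.hN i.D x.1)) y' := by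
    rw [← hy']; exact hcmp x.1 w₀ hg₂w₀
  have hG₁0 : 0 ≤ G₁ (blkCubeY i c (chartY i x.1.src)) := (abs_nonneg _).trans (hG₁ x.1)
  calc |b.repr ((((g₁ x.1 : ℝ) : ℂ)) • R (γ x.1)⁻¹ (M ν x.1)) x.2| ≤ M₂ * (G₁ (blkCubeY i c (chartY i x.1.src)) * ‖M ν x.1‖) := hrowfac
    _ ≤ M₂ * (G₁ (blkCubeY i c (chartY i x.1.src)) * ((∑ j, ‖b j‖) * (KC (blkCubeY i c (chartY i x.1.src)) s₀ * (M₂ * (G₂ s₀ * ((∑ j, ‖b j‖) * B)))))) :=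
        mul_le_mul_of_nonneg_left (mul_le_mul_of_nonneg_left hnorm hG₁0) hM₂
    _ = (M₂ * ∑ j, ‖b j‖) ^ 2 * (G₁ (blkCubeY i c (chartY i x.1.src)) * KC (blkCubeY i c (chartY i x.1.src)) (blkCubeY i c (chartY i w₀.src)) *
          G₂ (blkCubeY i c (chartY i w₀.src))) * B := by
        rw [hs₀]; ring
    _ ≤ (M₂ * ∑ j, ‖b j‖) ^ 2 * K (ιB (blkV1 i.hN i.D x.1)) y' * B :=
        mul_le_mul_of_nonneg_right (mul_le_mul_of_nonneg_left hc (sq_nonneg _)) hμ.nonneg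

end Transfer

/-! ## §2  The shapes of record: decaying cube-side kernels with length weights -/

section Decay

variable (i : KIdx d ℓ hd hL b₀ b₁) (c : ↥(cubes (toKT i).D.toDomains)) (b : Module.Basis ι ℝ 𝔸)

omit [CompleteSpace 𝔸] in
/-- ★★ **THE BOND SANDWICH TRANSFER FOR `K_C = B·ℓ_□(a)ⁿ·e^{−δd_□(a,a′)}`, ROW MULTIPLIER `|g₁| ≤ c₁·ℓ_□⁻ᵐ` (`m ≤ n`), CUT-OFF `|g₂| ≤ c₂` NEAR □**:
`conj b (M_{g₁}R(γ)⁻¹MR(γ)M_{g₂}) ≺ (M₂Σ‖b‖)²c₁c₂B·ℓ(a)^{n−m}·e^{−δd(a,a′)}` over the member's geometry — levels only grow and distances only shrink under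
coarsening (r05's p. 409 reading). [cite: Balaban1985BackgroundPropagators, Cor. 3.6 p.408, (3.89) p.409, Thm 3.3 (3.42) p.397∕399; Balaban1984PropagatorsII, (2.51) p.232, (2.46) p.231] -/
theorem hasMajorant_conj_bond_sandwich_decay {M₂ : ℝ} (hM₂ : 0 ≤ M₂) (hrepr : ∀ (v : 𝔸) (j : ι), |b.repr v j| ≤ M₂ * ‖v‖)
    (γ : FBondY i → 𝔸ˣ) (hγ : ∀ f a, ‖R (γ f) a‖ ≤ ‖a‖ ∧ ‖R (γ f)⁻¹ a‖ ≤ ‖a‖)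
    (g₁ g₂ : FBondY i → ℝ) {c₁ c₂ : ℝ} (hc₁ : 0 ≤ c₁) (hc₂ : 0 ≤ c₂) {m n : ℕ} (hmn : m ≤ n)
    (hg₁ : ∀ f, |g₁ f| * (geoCK i c).len (blkCubeY i c (chartY i f.src)) ^ m ≤ c₁) (hg₂ : ∀ f, |g₂ f| ≤ c₂)
    (hnear : ∀ f, g₂ f ≠ 0 → NearH c (chartY i f.src).1)
    (ιB : BlkY i → IBondY i) (hι : ∀ s, β i.hN i.D i.hk (ιB s) = s) (Rr : ℝ) (H : Prop) [Fintype (geo9K i).Site] (Rr' : ℝ) (Hp : Prop)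
    {B δ : ℝ} (hB : 0 ≤ B) (hδ : 0 ≤ δ) (M : Module.End ℝ (FBondY i → 𝔸))
    (hM : HasMajorant (g := toB6 (geoCK i c) Rr H) (blkBK i c) (conj b M) (fun a a' => B * (geoCK i c).len a ^ n * Real.exp (-(δ * (geoCK i c).dist a a')))) :
    HasMajorant (g := toB6 (geo9K i) Rr' Hp) (fun p : FBondY i × ι => ιB (blkV1 i.hN i.D p.1))
      (conj b ((cutMulY (𝔸 := 𝔸) g₁).restrictScalars ℝ ∘ₗ (conjY γ⁻¹).restrictScalars ℝ ∘ₗ M ∘ₗ (conjY γ).restrictScalars ℝ ∘ₗ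
        (cutMulY (𝔸 := 𝔸) g₂).restrictScalars ℝ))
      (fun a a' => (M₂ * ∑ j, ‖b j‖) ^ 2 * (c₁ * c₂ * B) * (geo9K i).len a ^ (n - m) * Real.exp (-(δ * (geo9K i).dist a a'))) := by
  have hlenpos : ∀ f : FBondY i, 0 < (geoCK i c).len (blkCubeY i c (chartY i f.src)) := fun f => geoCK_len_pos i c _
  refine hasMajorant_mono (g := toB6 (geo9K i) Rr' Hp) _
    (hasMajorant_conj_bond_sandwich i c b hM₂ hrepr γ hγ g₁ g₂ (fun s => c₁ * ((geoCK i c).len s ^ m)⁻¹) (fun _ => c₂)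
      (fun f => ?_) hg₂ hnear ιB hι Rr H Rr' Hp (K := fun a a' => (c₁ * c₂ * B) * (geo9K i).len a ^ (n - m) * Real.exp (-(δ * (geo9K i).dist a a')))
      (fun a a' => ?_) (fun x x₀ _ => ?_) M hM)
    fun a a' => le_of_eq (by ring)
  · have hp := pow_pos (hlenpos f) m
    rw [← div_eq_mul_inv, le_div_iff₀ hp]
    exact hg₁ f
  · exact mul_nonneg (mul_nonneg (mul_nonneg (mul_nonneg hc₁ hc₂) hB) (pow_nonneg (B6KLevelCensusIndexV1.len_pos i a).le _)) (Real.exp_nonneg _)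
  · have hlx := hlenpos x
    have hLC := len_cube_le_len_member i c ιB hι (chartY i x.src)
    have hdD := dist_member_le_dist_cube i c ιB hι (chartY i x.src) (chartY i x₀.src)
    have hpow : (geoCK i c).len (blkCubeY i c (chartY i x.src)) ^ n * ((geoCK i c).len (blkCubeY i c (chartY i x.src)) ^ m)⁻¹ =
        (geoCK i c).len (blkCubeY i c (chartY i x.src)) ^ (n - m) := by
      rw [pow_sub₀ _ hlx.ne' hmn]
    have hexp : Real.exp (-(δ * (geoCK i c).dist (blkCubeY i c (chartY i x.src)) (blkCubeY i c (chartY i x₀.src)))) ≤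
        Real.exp (-(δ * (geo9K i).dist (ιB (blkOf i.D.toDomains (chartY i x.src))) (ιB (blkOf i.D.toDomains (chartY i x₀.src))))) :=
      Real.exp_le_exp.2 (by nlinarith)
    have hpw : (geoCK i c).len (blkCubeY i c (chartY i x.src)) ^ (n - m) ≤ (geo9K i).len (ιB (blkOf i.D.toDomains (chartY i x.src))) ^ (n - m) :=
      pow_le_pow_left₀ hlx.le hLC _
    calc c₁ * ((geoCK i c).len (blkCubeY i c (chartY i x.src)) ^ m)⁻¹ * (B * (geoCK i c).len (blkCubeY i c (chartY i x.src)) ^ n *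
          Real.exp (-(δ * (geoCK i c).dist (blkCubeY i c (chartY i x.src)) (blkCubeY i c (chartY i x₀.src))))) * c₂
        = (c₁ * c₂ * B) * ((geoCK i c).len (blkCubeY i c (chartY i x.src)) ^ n * ((geoCK i c).len (blkCubeY i c (chartY i x.src)) ^ m)⁻¹) *
          Real.exp (-(δ * (geoCK i c).dist (blkCubeY i c (chartY i x.src)) (blkCubeY i c (chartY i x₀.src)))) := by ring
      _ = (c₁ * c₂ * B) * (geoCK i c).len (blkCubeY i c (chartY i x.src)) ^ (n - m) *
          Real.exp (-(δ * (geoCK i c).dist (blkCubeY i c (chartY i x.src)) (blkCubeY i c (chartY i x₀.src)))) := by rw [hpow]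
      _ ≤ (c₁ * c₂ * B) * (geo9K i).len (ιB (blkOf i.D.toDomains (chartY i x.src))) ^ (n - m) *
          Real.exp (-(δ * (geo9K i).dist (ιB (blkOf i.D.toDomains (chartY i x.src))) (ιB (blkOf i.D.toDomains (chartY i x₀.src))))) :=
          mul_le_mul (mul_le_mul_of_nonneg_left hpw (mul_nonneg (mul_nonneg hc₁ hc₂) hB)) hexp (Real.exp_nonneg _)
            (mul_nonneg (mul_nonneg (mul_nonneg hc₁ hc₂) hB) (pow_nonneg (B6KLevelCensusIndexV1.len_pos i _).le _))

omit [CompleteSpace 𝔸] in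
/-- ★★ **THE SOURCE-WEIGHTED VARIANT** (the right cut-off derivative of (3.42)₃): `K_C = B·ℓ_□(a)²·e^{−δd_□}`, `|g₁| ≤ c₁`, `|g₂| ≤ c₂·ℓ_□⁻¹` near □, and ONE
scale transfer of the cube geometry `e^{−αδd_□(a,a′)}ℓ_□(a′)⁻¹ ≤ Λ·ℓ_□(a)⁻¹` (p. 398 remark; p33's `hST_geoCK`, third component) ⟹
`≺ (M₂Σ‖b‖)²c₁c₂BΛ·ℓ(a)·e^{−(1−α)δd(a,a′)}` over the member's geometry.
[cite: Balaban1985BackgroundPropagators, Cor. 3.6 p.408, Thm 3.1 (3.42)₃ p.397, p.398 (remark after (3.47)); Balaban1984PropagatorsII, (2.51) p.232, (2.46) p.231] -/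
theorem hasMajorant_conj_bond_sandwich_decay_src {M₂ : ℝ} (hM₂ : 0 ≤ M₂) (hrepr : ∀ (v : 𝔸) (j : ι), |b.repr v j| ≤ M₂ * ‖v‖)
    (γ : FBondY i → 𝔸ˣ) (hγ : ∀ f a, ‖R (γ f) a‖ ≤ ‖a‖ ∧ ‖R (γ f)⁻¹ a‖ ≤ ‖a‖)
    (g₁ g₂ : FBondY i → ℝ) {c₁ c₂ : ℝ} (hc₁ : 0 ≤ c₁) (hc₂ : 0 ≤ c₂)
    (hg₁ : ∀ f, |g₁ f| ≤ c₁) (hg₂ : ∀ f, |g₂ f| * (geoCK i c).len (blkCubeY i c (chartY i f.src)) ≤ c₂) (hnear : ∀ f, g₂ f ≠ 0 → NearH c (chartY i f.src).1)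
    (ιB : BlkY i → IBondY i) (hι : ∀ s, β i.hN i.D i.hk (ιB s) = s) (Rr : ℝ) (H : Prop) [Fintype (geo9K i).Site] (Rr' : ℝ) (Hp : Prop)
    {B δ α Λ : ℝ} (hB : 0 ≤ B) (hδ : 0 ≤ δ) (hα1 : α ≤ 1) (hΛ : 0 ≤ Λ)
    (hST : ScaleTransfer (geoCK i c) δ α Λ (fun a => ((geoCK i c).len a)⁻¹))
    (M : Module.End ℝ (FBondY i → 𝔸))
    (hM : HasMajorant (g := toB6 (geoCK i c) Rr H) (blkBK i c) (conj b M) (fun a a' => B * (geoCK i c).len a ^ 2 * Real.exp (-(δ * (geoCK i c).dist a a')))) :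
    HasMajorant (g := toB6 (geo9K i) Rr' Hp) (fun p : FBondY i × ι => ιB (blkV1 i.hN i.D p.1))
      (conj b ((cutMulY (𝔸 := 𝔸) g₁).restrictScalars ℝ ∘ₗ (conjY γ⁻¹).restrictScalars ℝ ∘ₗ M ∘ₗ (conjY γ).restrictScalars ℝ ∘ₗ
        (cutMulY (𝔸 := 𝔸) g₂).restrictScalars ℝ))
      (fun a a' => (M₂ * ∑ j, ‖b j‖) ^ 2 * (c₁ * c₂ * B * Λ) * (geo9K i).len a * Real.exp (-((1 - α) * δ * (geo9K i).dist a a'))) := by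
  have hlenpos : ∀ f : FBondY i, 0 < (geoCK i c).len (blkCubeY i c (chartY i f.src)) := fun f => geoCK_len_pos i c _
  have hdnn := (geoCK_dist_axioms i c Rr H).1
  refine hasMajorant_mono (g := toB6 (geo9K i) Rr' Hp) _
    (hasMajorant_conj_bond_sandwich i c b hM₂ hrepr γ hγ g₁ g₂ (fun _ => c₁) (fun s => c₂ * ((geoCK i c).len s)⁻¹)
      hg₁ (fun f => ?_) hnear ιB hι Rr H Rr' Hp
      (K := fun a a' => (c₁ * c₂ * B * Λ) * (geo9K i).len a * Real.exp (-((1 - α) * δ * (geo9K i).dist a a')))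
      (fun a a' => ?_) (fun x x₀ _ => ?_) M hM)
    fun a a' => le_of_eq (by ring)
  · rw [← div_eq_mul_inv, le_div_iff₀ (hlenpos f)]
    exact hg₂ f
  · exact mul_nonneg (mul_nonneg (mul_nonneg (mul_nonneg (mul_nonneg hc₁ hc₂) hB) hΛ) (B6KLevelCensusIndexV1.len_pos i a).le) (Real.exp_nonneg _)
  · have hlx := hlenpos x
    have hLC := len_cube_le_len_member i c ιB hι (chartY i x.src)
    have hdD := dist_member_le_dist_cube i c ιB hι (chartY i x.src) (chartY i x₀.src)
    set ax := blkCubeY i c (chartY i x.src) with hax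
    set a0 := blkCubeY i c (chartY i x₀.src) with ha0
    set dC := (geoCK i c).dist ax a0 with hdC
    have hT := hST ax a0
    have hsplit : Real.exp (-(δ * dC)) = Real.exp (-(α * δ * dC)) * Real.exp (-((1 - α) * δ * dC)) := by
      rw [← Real.exp_add]; ring_nf
    have hexp : Real.exp (-((1 - α) * δ * dC)) ≤
        Real.exp (-((1 - α) * δ * (geo9K i).dist (ιB (blkOf i.D.toDomains (chartY i x.src))) (ιB (blkOf i.D.toDomains (chartY i x₀.src))))) := by
      refine Real.exp_le_exp.2 ?_
      have h1 : 0 ≤ (1 - α) * δ := mul_nonneg (by linarith) hδ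
      nlinarith
    have key : ((geoCK i c).len ax) ^ 2 * Real.exp (-(δ * dC)) * ((geoCK i c).len a0)⁻¹ ≤ Λ * (geoCK i c).len ax * Real.exp (-((1 - α) * δ * dC)) := by
      rw [hsplit]
      have h2 : Real.exp (-(α * δ * dC)) * ((geoCK i c).len a0)⁻¹ ≤ Λ * ((geoCK i c).len ax)⁻¹ := hT
      have hl2 : 0 ≤ (geoCK i c).len ax ^ 2 * Real.exp (-((1 - α) * δ * dC)) := mul_nonneg (sq_nonneg _) (Real.exp_nonneg _)
      calc (geoCK i c).len ax ^ 2 * (Real.exp (-(α * δ * dC)) * Real.exp (-((1 - α) * δ * dC))) * ((geoCK i c).len a0)⁻¹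
          = ((geoCK i c).len ax ^ 2 * Real.exp (-((1 - α) * δ * dC))) * (Real.exp (-(α * δ * dC)) * ((geoCK i c).len a0)⁻¹) := by ring
        _ ≤ ((geoCK i c).len ax ^ 2 * Real.exp (-((1 - α) * δ * dC))) * (Λ * ((geoCK i c).len ax)⁻¹) := mul_le_mul_of_nonneg_left h2 hl2
        _ = Λ * (geoCK i c).len ax * Real.exp (-((1 - α) * δ * dC)) := by field_simp
    have hpre : 0 ≤ c₁ * c₂ * B := mul_nonneg (mul_nonneg hc₁ hc₂) hB
    calc c₁ * (B * (geoCK i c).len ax ^ 2 * Real.exp (-(δ * dC))) * (c₂ * ((geoCK i c).len a0)⁻¹)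
        = (c₁ * c₂ * B) * ((geoCK i c).len ax ^ 2 * Real.exp (-(δ * dC)) * ((geoCK i c).len a0)⁻¹) := by ring
      _ ≤ (c₁ * c₂ * B) * (Λ * (geoCK i c).len ax * Real.exp (-((1 - α) * δ * dC))) := mul_le_mul_of_nonneg_left key hpre
      _ = (c₁ * c₂ * B * Λ) * (geoCK i c).len ax * Real.exp (-((1 - α) * δ * dC)) := by ring
      _ ≤ (c₁ * c₂ * B * Λ) * (geo9K i).len (ιB (blkOf i.D.toDomains (chartY i x.src))) *
          Real.exp (-((1 - α) * δ * (geo9K i).dist (ιB (blkOf i.D.toDomains (chartY i x.src))) (ιB (blkOf i.D.toDomains (chartY i x₀.src))))) :=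
          mul_le_mul (mul_le_mul_of_nonneg_left hLC (mul_nonneg hpre hΛ)) hexp (Real.exp_nonneg _)
            (mul_nonneg (mul_nonneg hpre hΛ) (B6KLevelCensusIndexV1.len_pos i _).le)

end Decay

end Literature.MathematicalPhysics.QuantumFieldTheory.Balaban1983to89.B9Cor36BondSandwichTransfer

end
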